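import Literature.Analysis.FluidPDE.NSHopfGalerkinExistence
import Literature.Analysis.FluidPDE.NSHopfGalerkinLimit
import Literature.Analysis.FluidPDE.NSGalerkinEnstrophy2D
import Literature.Analysis.FluidPDE.NSGalerkinSteadyScheme
import Literature.Analysis.FluidPDE.NSStrongSolutions2D
import Literature.Analysis.FluidPDE.NSEnstrophyBalance2DGalerkin
import Literature.Analysis.FluidPDE.KochTataruFixedPoint
import Literature.Analysis.FluidPDE.AlexakisDoeringInterpolation
import Literature.Analysis.FluidPDE.LerayHopfSpectralMeasurability
import Literature.Analysis.FunctionSpaces.TorusSobolevNormProofs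
import Literature.Analysis.FunctionSpaces.TorusEnstrophyOrthogonality
import HarnessLib

/-!
# The enstrophy inequality of the Fourier–Galerkin scheme on `UnitAddTorus (Fin 2)` and of its Leray–Hopf limit
  (discharge of `fmrt_strong_existence_torus2`)

Trunk: FluidKinetic. Foias–Manley–Rosa–Temam 2001, Ch. II, Thm. 7.4 with App. A (A.62), (A.65):
in the two-dimensional space-periodic case the trilinear term is orthogonal to the Laplacian,
`b(u,u,Au) = 0`, so that along a (Galerkin) solution
`½ d/dt ‖∇u‖² + ν‖Δu‖² = (f, -Δu) ≤ ½ν‖Δu‖² + ½ν⁻¹‖f‖²`; Kuksin–Shirikyan 2012, proof of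
Thm. 2.1.18 ("Its justification can be carried out with the help of the Galerkin
approximation"), Lemma 2.1.16. This file runs that argument on the tree's Fourier–Galerkin
machinery (`NSGalerkinFourier`, `NSHopfGalerkinExistence`, `NSHopfLimit`,
`NSHopfGalerkinLimit`, all general `d`; the spectral Laplacian norm of Galerkin states, the
coefficient calculus `d/dt ∑|k|²‖β k‖²`, the slicewise Fatou lemma for `‖Δ·‖₂²`, the bound
`‖·‖²_{H²} ≤ 2‖·‖²_{L²} + 2‖Δ·‖₂²` and the superadditivity of `liminf` in `ℝ≥0∞` are reused from
`NSGalerkinEnstrophy2D`, `NSGalerkinSteadyScheme`, `NSEnstrophyBalance2DGalerkin` and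
`KochTataruFixedPoint`) and proves the named fact
`fmrt_strong_existence_torus2` of `NSStrongSolutions2D`:

* Fourier side (general `d`): the Laplacian of a Galerkin state
  (`laplacian_realTrigPoly_eq`), its classical `‖Δu‖₂²` as a finite sum and its agreement with
  `Turb.eLaplacianNormSq` (`integral_norm_sq_laplacian_realTrigPoly`,
  `toReal_eLaplacianNormSq_realTrigPoly_eq_integral`), and the tested Galerkin field against
  `Δu` (`sum_freqNormSq_mul_re_inner_galerkinField`):
  `-4π² ∑ₖ |k|² Re⟪c_k, V(c)_k⟫ = ∫⟪u,(u·∇)Δu⟫ + ν‖Δu‖₂² + ∫⟪G, Δu⟫`.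
* `d = 2`: `∫⟪u,(u·∇)Δu⟫ = 0` (`Torus.integral_inner_laplacian_convect_self_eq_zero`, FMRT
  (A.62)), whence the differential enstrophy identity along the Galerkin ODE
  (`hasDerivWithinAt_toReal_eGradNormSq_fin_two`), the bound `d/dt‖∇u‖² ≤ -ν‖Δu‖² + ν⁻¹‖G‖²`, and the
  integrated **enstrophy inequality of the Galerkin solutions**
  (`galerkin_enstrophy_inequality`, in `ℝ≥0∞` form `galerkin_enstrophy_inequality_ennreal`).
* The scheme: `exists_isHopfGalerkinScheme_enstrophy` — on `UnitAddTorus (Fin 2)` the Hopf–Galerkin scheme of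
  `NS.exists_isHopfGalerkinScheme` (same construction) satisfies in addition
  `‖∇U n(t)‖² + ν∫₀ᵗ‖ΔU n‖² ≤ ‖∇u₀‖² + ν⁻¹∫₀ᵗ‖F n‖²` for `u₀ ∈ H¹`.
* The limit: Fatou slicewise and in time, and `∫₀ᵗ‖F n‖² ≤ (1+δ)∫₀ᵗ‖f‖² + δ` eventually
  (`IsHopfGalerkinScheme.eventually_lintegral_force_le`), give the enstrophy inequality
  (`IsHopfGalerkinScheme.enstrophy_ineq_limit`) and `u ∈ L²(0,T;H²)`
  (`IsHopfGalerkinScheme.memL2Sobolev_two_limit`) for the Leray–Hopf limit of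
  `exists_limitField`, whence `strong_existence_enstrophy_torus2` and
  **`fmrt_strong_existence_torus2_holds`** (`NSStrongSolutions2D`).

## References

* C. Foias, O. Manley, R. Rosa, R. Temam, *Navier–Stokes Equations and Turbulence*, CUP 2001,
  Ch. II Thm. 7.4, App. A (A.62), (A.65)–(A.67). [FoiasManleyRosaTemam2001]
* S. Kuksin, A. Shirikyan, *Mathematics of Two-Dimensional Turbulence*, CUP 2012, Thm. 2.1.13,
  Lemma 2.1.16, Thm. 2.1.18. [KuksinShirikyan2012]
* J. C. Robinson, J. L. Rodrigo, W. Sadowski, *The three-dimensional Navier–Stokes equations*,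
  CUP 2016, Thm. 4.4 (the Galerkin scheme).
-/

noncomputable section

open MeasureTheory Set Filter Topology UnitAddTorus
open scoped ENNReal NNReal InnerProductSpace

namespace Literature.Analysis.FluidPDE

section Fourier

open FunctionSpaces.Torus Torus

variable {d : Type*} [Fintype d]

/-! ### The Laplacian of a real trigonometric polynomial -/

/-- The Laplacian multiplier `-4π²|k|²` (a complex scalar, `Torus.laplacian_realTrigPoly`) as a
real scalar multiple: `-((4π²|k|² : ℂ) • w) = (-4π²|k|²) • w`. [folklore] -/
theorem neg_lapMul_smul_eq_real_smul (k : d → ℤ) (w : EuclideanSpace ℂ d) :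
    -(((4 * Real.pi ^ 2 * freqNormSq k : ℝ) : ℂ) • w) =
      (-(4 * Real.pi ^ 2 * freqNormSq k) : ℝ) • w := by
  rw [Complex.coe_smul, neg_smul]  -- `(r : ℂ) • w = r • w` definitionally, then `neg_smul`

/-- **`Δ (realTrigPoly S c) = realTrigPoly S (k ↦ -4π²|k|² • c k)`** as functions
(`Torus.laplacian_realTrigPoly`). [cite: Grafakos2014, Prop. 3.2.6] -/
theorem laplacian_realTrigPoly_eq [DecidableEq d] (S : Finset (d → ℤ))
    (c : (d → ℤ) → EuclideanSpace ℂ d) :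
    laplacian (realTrigPoly S c) =
      realTrigPoly S (fun k => -(((4 * Real.pi ^ 2 * freqNormSq k : ℝ) : ℂ) • c k)) :=
  funext fun x => laplacian_realTrigPoly S c x

/-- `‖-4π²|k|² • c k‖² = 16π⁴ |k|⁴ ‖c k‖²`. [folklore] -/
theorem norm_lapMul_sq (c : (d → ℤ) → EuclideanSpace ℂ d) (k : d → ℤ) :
    ‖-(((4 * Real.pi ^ 2 * freqNormSq k : ℝ) : ℂ) • c k)‖ ^ 2 =
      16 * Real.pi ^ 4 * freqNormSq k ^ 2 * ‖c k‖ ^ 2 := by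
  rw [neg_lapMul_smul_eq_real_smul, norm_smul, Real.norm_eq_abs, abs_neg,
    abs_of_nonneg (mul_nonneg (by positivity) (freqNormSq_nonneg k))]
  ring

/-- **`‖Δu‖₂²` of a real trigonometric polynomial**: `∫ ‖Δ realTrigPoly S c‖² =
16π⁴ ∑_{k∈S} |k|⁴ ‖c k‖²` (conjugate-symmetric `c`, symmetric `S`; finite Parseval). [folklore] -/
theorem integral_norm_sq_laplacian_realTrigPoly [DecidableEq d] {S : Finset (d → ℤ)}
    (hS : ∀ k ∈ S, -k ∈ S) {c : (d → ℤ) → EuclideanSpace ℂ d} (hc : IsConjSymm c) :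
    ∫ x, ‖laplacian (realTrigPoly S c) x‖ ^ 2 =
      16 * Real.pi ^ 4 * ∑ k ∈ S, freqNormSq k ^ 2 * ‖c k‖ ^ 2 := by
  rw [laplacian_realTrigPoly_eq, integral_norm_sq_realTrigPoly hS (isConjSymm_laplacianCoeff hc), Finset.mul_sum]
  exact Finset.sum_congr rfl fun k _ => by rw [norm_lapMul_sq]; ring

/-- For a Galerkin state, the spectral and the classical `‖Δu‖₂²` agree:
`(eLaplacianNormSq u).toReal = ∫ ‖Δu‖²`. [folklore] -/
theorem toReal_eLaplacianNormSq_realTrigPoly_eq_integral [DecidableEq d] {S : Finset (d → ℤ)}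
    (hS : ∀ k ∈ S, -k ∈ S) {c : (d → ℤ) → EuclideanSpace ℂ d} (hc : IsConjSymm c) :
    (eLaplacianNormSq (realTrigPoly S c)).toReal = ∫ x, ‖laplacian (realTrigPoly S c) x‖ ^ 2 := by
  rw [toReal_eLaplacianNormSq_realTrigPoly hS hc, integral_norm_sq_laplacian_realTrigPoly hS hc]

/-! ### The Galerkin field tested against the Laplacian of the state -/

variable [DecidableEq d] {S : Finset (d → ℤ)}

/-- **The Galerkin vector field paired with `-Δu` on the Fourier side** (general dimension):
for conjugate-symmetric transversal `c` and conjugate-symmetric `g` on a symmetric `S`, with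
`u = realTrigPoly S c`, `G = realTrigPoly S g`,
`-4π² ∑_{k∈S} |k|² Re⟪c k, V(c) k⟫ = ∫⟪u, (u·∇)Δu⟫ + ν ∫‖Δu‖² + ∫⟪G, Δu⟫` — the tested Galerkin
equations (`Torus.sum_re_inner_galerkinField_test`) with the Galerkin mode `a = Δu`
(coefficients `-4π²|k|² c k`), and `∫⟪u, ΔΔu⟫ = ∫‖Δu‖²` (Green). This is the enstrophy equation
(A.55) of Foias–Manley–Rosa–Temam 2001 at the Galerkin level, before the 2-D cancellation. [cite: FoiasManleyRosaTemam2001, App. II.A (A.55)] -/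
theorem sum_freqNormSq_mul_re_inner_galerkinField (ν : ℝ) (hS : ∀ k ∈ S, -k ∈ S)
    {g c : (d → ℤ) → EuclideanSpace ℂ d} (hg : IsConjSymm g) (hc : IsConjSymm c)
    (hcT : IsTransversal S c) :
    -(4 * Real.pi ^ 2) * ∑ k ∈ S, freqNormSq k * (inner ℂ (c k) (galerkinField ν S g c k)).re =
      (∫ x, ⟪realTrigPoly S c x, FunctionSpaces.Torus.convect (realTrigPoly S c) (laplacian (realTrigPoly S c)) x⟫_ℝ) +
        ν * (∫ x, ‖laplacian (realTrigPoly S c) x‖ ^ 2) +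
        ∫ x, ⟪realTrigPoly S g x, laplacian (realTrigPoly S c) x⟫_ℝ := by
  have hu : IsSmooth (realTrigPoly S c) := isSmooth_realTrigPoly S c
  set a := laplacian (realTrigPoly S c) with ha_def
  have ha : IsSmooth a := hu.laplacian
  have hdiva : IsDivFree a := by
    rw [ha_def, laplacian_realTrigPoly_eq]
    exact isDivFree_realTrigPoly (isTransversal_laplacianCoeff hcT)
  have hcoef : ∀ k, mFourierCoeff (FunctionSpaces.EuclideanSpace.complexify ∘ a) k =
      if k ∈ S then -(((4 * Real.pi ^ 2 * freqNormSq k : ℝ) : ℂ) • c k) else 0 := fun k => by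
    rw [ha_def, laplacian_realTrigPoly_eq, mFourierCoeff_realTrigPoly hS (isConjSymm_laplacianCoeff hc)]
  have hband : ∀ k ∉ S, mFourierCoeff (FunctionSpaces.EuclideanSpace.complexify ∘ a) k = 0 := fun k hk => by
    rw [hcoef, if_neg hk]
  have htest := sum_re_inner_galerkinField_test ν hS hg hc hcT ha hdiva hband
  -- the left-hand side: `Re ⟪V_k, -4π²|k|² c_k⟫ = -4π²|k|² Re ⟪c_k, V_k⟫`
  have hlhs : ∑ k ∈ S, (inner ℂ (galerkinField ν S g c k)
      (mFourierCoeff (FunctionSpaces.EuclideanSpace.complexify ∘ a) k)).re =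
      -(4 * Real.pi ^ 2) * ∑ k ∈ S, freqNormSq k * (inner ℂ (c k) (galerkinField ν S g c k)).re := by
    rw [Finset.mul_sum]
    refine Finset.sum_congr rfl fun k hk => ?_
    have hsym : (inner ℂ (galerkinField ν S g c k) (c k)).re =
        (inner ℂ (c k) (galerkinField ν S g c k)).re := inner_re_symm (𝕜 := ℂ) _ _
    rw [hcoef, if_pos hk, inner_neg_right, Complex.neg_re, inner_smul_right,
      Complex.re_ofReal_mul, hsym]
    ring
  -- the viscous term: `∫⟪u, Δ(Δu)⟫ = ∫ ‖Δu‖²`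
  have hvisc : ∫ x, ⟪realTrigPoly S c x, laplacian a x⟫_ℝ = ∫ x, ‖a x‖ ^ 2 := by
    rw [← FunctionSpaces.Torus.integral_inner_laplacian_comm hu ha]
    exact integral_congr_ae (ae_of_all _ fun x => real_inner_self_eq_norm_sq (a x))
  have hint1 : Integrable (fun x => ⟪realTrigPoly S c x, FunctionSpaces.Torus.convect (realTrigPoly S c) a x⟫_ℝ) volume :=
    (hu.inner (hu.convect ha)).integrable
  have hint2 : Integrable (fun x => ν * ⟪realTrigPoly S c x, laplacian a x⟫_ℝ) volume :=
    ((hu.inner ha.laplacian).integrable).const_mul ν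
  have hint3 : Integrable (fun x => ⟪realTrigPoly S g x, a x⟫_ℝ) volume :=
    ((isSmooth_realTrigPoly S g).inner ha).integrable
  have hint12 : Integrable (fun x => ⟪realTrigPoly S c x, FunctionSpaces.Torus.convect (realTrigPoly S c) a x⟫_ℝ +
      ν * ⟪realTrigPoly S c x, laplacian a x⟫_ℝ) volume := hint1.add hint2
  rw [← hlhs, htest, integral_add hint12 hint3, integral_add hint1 hint2,
    integral_const_mul, hvisc]

/-- **FMRT (A.62) ⇒ (A.65) at the Galerkin level, `d = 2`**: on `UnitAddTorus (Fin 2)` the trilinear term drops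
out, `∫⟪u, (u·∇)Δu⟫ = -∫⟪(u·∇)u, Δu⟫ = 0` (`Torus.integral_inner_laplacian_convect_self_eq_zero`),
so `-4π² ∑_{k∈S} |k|² Re⟪c k, V(c) k⟫ = ν ∫‖Δu‖² + ∫⟪G, Δu⟫`. [cite: FoiasManleyRosaTemam2001, App. II.A (A.62), (A.65)] -/
theorem sum_freqNormSq_mul_re_inner_galerkinField_fin_two (ν : ℝ) {S : Finset (Fin 2 → ℤ)}
    (hS : ∀ k ∈ S, -k ∈ S) {g c : (Fin 2 → ℤ) → EuclideanSpace ℂ (Fin 2)} (hg : IsConjSymm g)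
    (hc : IsConjSymm c) (hcT : IsTransversal S c) :
    -(4 * Real.pi ^ 2) * ∑ k ∈ S, freqNormSq k * (inner ℂ (c k) (galerkinField ν S g c k)).re =
      ν * (∫ x, ‖laplacian (realTrigPoly S c) x‖ ^ 2) +
        ∫ x, ⟪realTrigPoly S g x, laplacian (realTrigPoly S c) x⟫_ℝ := by
  have hu : IsSmooth (realTrigPoly S c) := isSmooth_realTrigPoly S c
  have hdiv : IsDivFree (realTrigPoly S c) := isDivFree_realTrigPoly hcT
  have htri : ∫ x, ⟪realTrigPoly S c x,
      FunctionSpaces.Torus.convect (realTrigPoly S c) (laplacian (realTrigPoly S c)) x⟫_ℝ = 0 := by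
    have h1 := integral_inner_convect_eq_neg (v := realTrigPoly S c)
      (w := laplacian (realTrigPoly S c)) hu hdiv hu hu.laplacian
    have h2 : ∫ x, ⟪FunctionSpaces.Torus.convect (realTrigPoly S c) (realTrigPoly S c) x,
        laplacian (realTrigPoly S c) x⟫_ℝ = 0 := by
      rw [← integral_inner_laplacian_convect_self_eq_zero hu hdiv]
      exact integral_congr_ae (ae_of_all _ fun x => real_inner_comm _ _)
    linarith
  rw [sum_freqNormSq_mul_re_inner_galerkinField ν hS hg hc hcT, htri, zero_add]

end Fourier

/-! ### The enstrophy inequality along the Galerkin ODE, `d = 2` -/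

section ODE

open FunctionSpaces.Torus Torus

variable {d : Type*} [Fintype d] [DecidableEq d] {S : Finset (d → ℤ)}

/-- Young's inequality for the force term of the enstrophy equation: for `ν > 0`,
`-2⟪a, b⟫ ≤ ν ‖b‖² + ν⁻¹ ‖a‖²`. [folklore] -/
theorem neg_two_mul_inner_le {E : Type*} [NormedAddCommGroup E] [InnerProductSpace ℝ E]
    {ν : ℝ} (hν : 0 < ν) (a b : E) : -(2 * ⟪a, b⟫_ℝ) ≤ ν * ‖b‖ ^ 2 + ν⁻¹ * ‖a‖ ^ 2 := by
  have h1 : -(2 * ⟪a, b⟫_ℝ) ≤ 2 * (‖a‖ * ‖b‖) := by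
    have := abs_real_inner_le_norm a b
    have := neg_abs_le ⟪a, b⟫_ℝ
    linarith
  have key : ν * ‖b‖ ^ 2 + ν⁻¹ * ‖a‖ ^ 2 - 2 * (‖a‖ * ‖b‖) = ν⁻¹ * (ν * ‖b‖ - ‖a‖) ^ 2 := by
    field_simp
    ring
  have h2 : 0 ≤ ν⁻¹ * (ν * ‖b‖ - ‖a‖) ^ 2 := mul_nonneg (inv_nonneg.2 hν.le) (sq_nonneg _)
  linarith

omit [DecidableEq d] in
/-- Along a continuous coefficient curve in the Galerkin phase space, `τ ↦ ∫ ‖Δu(τ)‖²` is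
continuous (`u(τ) = realTrigPoly S ᾱ(τ)`; Fourier side `16π⁴ ∑ |k|⁴ ‖α τ k‖²`). [folklore] -/
theorem continuousOn_integral_norm_sq_laplacian_galerkin [DecidableEq d] (hS : ∀ k ∈ S, -k ∈ S)
    {α : ℝ → ↥S → EuclideanSpace ℂ d} (hmem : ∀ t, α t ∈ galerkinSubspace S) {s : Set ℝ}
    (hα : ContinuousOn α s) :
    ContinuousOn (fun τ => ∫ x, ‖laplacian (realTrigPoly S (coeffExt S (α τ))) x‖ ^ 2) s := by
  have heq : (fun τ => ∫ x, ‖laplacian (realTrigPoly S (coeffExt S (α τ))) x‖ ^ 2) =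
      fun τ => 16 * Real.pi ^ 4 * ∑ k : ↥S, freqNormSq (k : d → ℤ) ^ 2 * ‖α τ k‖ ^ 2 := by
    funext τ
    rw [integral_norm_sq_laplacian_realTrigPoly hS ((hmem τ).1.isConjSymm_coeffExt hS),
      sum_coeffExt (fun k v => freqNormSq k ^ 2 * ‖v‖ ^ 2)]
  rw [heq]
  refine continuousOn_const.mul (continuousOn_finsetSum _ fun k _ => ?_)
  exact continuousOn_const.mul (((continuous_apply k).comp_continuousOn hα).norm.pow 2)

omit [DecidableEq d] in
/-- Along continuous real force coefficients, `τ ↦ ∫ ‖G(τ)‖²` is continuous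
(`G(τ) = realTrigPoly S ḡ(τ)`; Fourier side `∑ ‖g τ k‖²`). [folklore] -/
theorem continuousOn_integral_norm_sq_galerkin (hS : ∀ k ∈ S, -k ∈ S)
    {g : ℝ → ↥S → EuclideanSpace ℂ d} (hgr : ∀ t, IsRealCoeff (g t)) {s : Set ℝ}
    (hg : ContinuousOn g s) :
    ContinuousOn (fun τ => ∫ x, ‖realTrigPoly S (coeffExt S (g τ)) x‖ ^ 2) s := by
  have heq : (fun τ => ∫ x, ‖realTrigPoly S (coeffExt S (g τ)) x‖ ^ 2) =
      fun τ => ∑ k : ↥S, ‖g τ k‖ ^ 2 := by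
    funext τ
    rw [integral_norm_sq_realTrigPoly hS ((hgr τ).isConjSymm_coeffExt hS),
      sum_coeffExt (fun _ v => ‖v‖ ^ 2)]
  rw [heq]
  exact continuousOn_finsetSum _ fun k _ => ((continuous_apply k).comp_continuousOn hg).norm.pow 2

/-- The integral over `(0, t)` of a nonnegative function continuous on `[0, t]`, as a lower
Lebesgue integral: `∫⁻_{(0,t)} ofReal (E τ) = ofReal (∫₀ᵗ E)`. [folklore] -/
theorem lintegral_Ioo_ofReal_eq_ofReal_intervalIntegral {E : ℝ → ℝ} {t : ℝ} (ht : 0 ≤ t)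
    (hE : ContinuousOn E (Icc 0 t)) (hnn : ∀ τ, 0 ≤ E τ) :
    ∫⁻ τ in Ioo 0 t, ENNReal.ofReal (E τ) = ENNReal.ofReal (∫ τ in 0..t, E τ) := by
  have hint : IntegrableOn E (Ioo 0 t) volume :=
    (hE.integrableOn_compact isCompact_Icc).mono_set Ioo_subset_Icc_self
  rw [← ofReal_integral_eq_lintegral_ofReal hint (ae_of_all _ hnn),
    intervalIntegral.integral_of_le ht, integral_Ioc_eq_integral_Ioo]

/-- **The enstrophy equation in differential form along a 2-D Galerkin solution**
(Foias–Manley–Rosa–Temam 2001, (A.65) at the Galerkin level; Kuksin–Shirikyan 2012, proof of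
Thm. 2.1.18). On `UnitAddTorus (Fin 2)`, if `β' = V(g, β)` within `s` at `t`, with `β τ` real and divergence free
for all `τ` and `g` real, then with `u = realTrigPoly S β̄(t)`, `G = realTrigPoly S ḡ`:
`d/dt ‖∇u‖₂² = -2 (ν ‖Δu‖₂² + ∫⟪G, Δu⟫)`. [cite: FoiasManleyRosaTemam2001, App. II.A (A.65)] -/
theorem hasDerivWithinAt_toReal_eGradNormSq_fin_two (ν : ℝ) {S : Finset (Fin 2 → ℤ)} (hS : ∀ k ∈ S, -k ∈ S)
    {β : ℝ → ↥S → EuclideanSpace ℂ (Fin 2)} {g : ↥S → EuclideanSpace ℂ (Fin 2)} {s : Set ℝ}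
    {t : ℝ} (h : HasDerivWithinAt β (galerkinRHS S ν g (β t)) s t)
    (hβ : ∀ τ, β τ ∈ galerkinSubspace S) (hg : IsRealCoeff g) :
    HasDerivWithinAt (fun τ => (eGradNormSq (realTrigPoly S (coeffExt S (β τ)))).toReal)
      (-2 * (ν * (∫ x, ‖laplacian (realTrigPoly S (coeffExt S (β t))) x‖ ^ 2) +
        ∫ x, ⟪realTrigPoly S (coeffExt S g) x,
          laplacian (realTrigPoly S (coeffExt S (β t))) x⟫_ℝ)) s t := by
  have hfun : (fun τ => (eGradNormSq (realTrigPoly S (coeffExt S (β τ)))).toReal) =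
      fun τ => 4 * Real.pi ^ 2 * ∑ k : ↥S, freqNormSq (k : Fin 2 → ℤ) * ‖β τ k‖ ^ 2 :=
    funext fun τ => toReal_eGradNormSq_coeffExt hS (hβ τ).1
  rw [hfun]
  have h1 := (hasDerivWithinAt_sum_freqNormSq_mul_norm_sq h).const_mul (4 * Real.pi ^ 2)
  have h2 : ∑ k : ↥S, freqNormSq (k : Fin 2 → ℤ) * (2 * (inner ℂ (β t k) (galerkinRHS S ν g (β t) k)).re) =
      2 * ∑ k ∈ S, freqNormSq k * (inner ℂ (coeffExt S (β t) k)
        (galerkinField ν S (coeffExt S g) (coeffExt S (β t)) k)).re := by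
    rw [Finset.mul_sum, sum_coeffExt (fun k v => 2 * (freqNormSq k * (inner ℂ v
      (galerkinField ν S (coeffExt S g) (coeffExt S (β t)) k)).re))]
    exact Finset.sum_congr rfl fun k _ => by rw [galerkinRHS_apply]; ring
  have h3 := sum_freqNormSq_mul_re_inner_galerkinField_fin_two ν hS (hg.isConjSymm_coeffExt hS)
    ((hβ t).1.isConjSymm_coeffExt hS) (hβ t).2.isTransversal_coeffExt
  rw [h2] at h1
  exact h1.congr_deriv (by linear_combination (-2 : ℝ) * h3)

/-- **The integrated enstrophy inequality of 2-D Galerkin solutions** (Foias–Manley–Rosa–Temam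
2001, (A.65) integrated with Young `(f, Au) ≤ ½ν|Au|² + ½ν⁻¹|f|²`, cf. Kuksin–Shirikyan
2012, (2.43) and the proof of Thm. 2.1.18). Let `α` solve the Galerkin ODE on every
`[0, T]` in the Galerkin phase space of `UnitAddTorus (Fin 2)`, with continuous real force coefficients `g` and
`ν > 0`, and put `u(τ) = realTrigPoly S ᾱ(τ)`, `G(τ) = realTrigPoly S ḡ(τ)`. Then for `t ≥ 0`,
`‖∇u(t)‖₂² + ν ∫₀ᵗ ‖Δu‖₂² ≤ ‖∇u(0)‖₂² + ν⁻¹ ∫₀ᵗ ‖G‖₂²`. [cite: FoiasManleyRosaTemam2001, Ch. II Thm. 7.4 and (A.65)–(A.67)] -/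
theorem galerkin_enstrophy_inequality {ν : ℝ} (hν : 0 < ν) {S : Finset (Fin 2 → ℤ)}
    (hS : ∀ k ∈ S, -k ∈ S) {g : ℝ → ↥S → EuclideanSpace ℂ (Fin 2)} (hg : Continuous g)
    (hgr : ∀ t, IsRealCoeff (g t)) {α : ℝ → ↥S → EuclideanSpace ℂ (Fin 2)}
    (hmem : ∀ t, α t ∈ galerkinSubspace S)
    (hα : ∀ T, ∀ t ∈ Icc 0 T, HasDerivWithinAt α (galerkinRHS S ν (g t) (α t)) (Icc 0 T) t)
    {t : ℝ} (ht : 0 ≤ t) :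
    (eGradNormSq (realTrigPoly S (coeffExt S (α t)))).toReal +
        ν * ∫ τ in 0..t, ∫ x, ‖laplacian (realTrigPoly S (coeffExt S (α τ))) x‖ ^ 2 ≤
      (eGradNormSq (realTrigPoly S (coeffExt S (α 0)))).toReal +
        ν⁻¹ * ∫ τ in 0..t, ∫ x, ‖realTrigPoly S (coeffExt S (g τ)) x‖ ^ 2 := by
  -- the enstrophy, the enstrophy dissipation, the force pairing and the force energy
  obtain ⟨E₁, hE₁⟩ : ∃ E : ℝ → ℝ,
      E = fun τ => (eGradNormSq (realTrigPoly S (coeffExt S (α τ)))).toReal := ⟨_, rfl⟩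
  obtain ⟨E₂, hE₂⟩ : ∃ E : ℝ → ℝ,
      E = fun τ => ∫ x, ‖laplacian (realTrigPoly S (coeffExt S (α τ))) x‖ ^ 2 := ⟨_, rfl⟩
  obtain ⟨P, hP⟩ : ∃ P : ℝ → ℝ, P = fun τ => ∫ x, ⟪realTrigPoly S (coeffExt S (g τ)) x,
      laplacian (realTrigPoly S (coeffExt S (α τ))) x⟫_ℝ := ⟨_, rfl⟩
  obtain ⟨Q, hQ⟩ : ∃ Q : ℝ → ℝ,
      Q = fun τ => ∫ x, ‖realTrigPoly S (coeffExt S (g τ)) x‖ ^ 2 := ⟨_, rfl⟩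
  have hderiv : ∀ T, ∀ τ ∈ Icc 0 T, HasDerivWithinAt E₁ (-2 * (ν * E₂ τ + P τ)) (Icc 0 T) τ := by
    intro T τ hτ
    subst hE₁ hE₂ hP
    exact hasDerivWithinAt_toReal_eGradNormSq_fin_two ν hS (hα T τ hτ) hmem (hgr τ)
  have hα_cont : ContinuousOn α (Icc 0 t) := fun τ hτ => (hα t τ hτ).continuousWithinAt
  have hg_cont : ContinuousOn g (Icc 0 t) := hg.continuousOn
  -- continuity on `[0, t]` (Fourier side)
  have hE₂_cont : ContinuousOn E₂ (Icc 0 t) := by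
    subst hE₂; exact continuousOn_integral_norm_sq_laplacian_galerkin hS hmem hα_cont
  have hP_eq : ∀ τ, P τ = ∑ k : ↥S, (inner ℂ (g τ k)
      (-(((4 * Real.pi ^ 2 * freqNormSq (k : Fin 2 → ℤ) : ℝ) : ℂ) • coeffExt S (α τ) k))).re := by
    intro τ; subst hP
    show ∫ x, ⟪realTrigPoly S (coeffExt S (g τ)) x,
      laplacian (realTrigPoly S (coeffExt S (α τ))) x⟫_ℝ = _
    rw [laplacian_realTrigPoly_eq, integral_inner_realTrigPoly_realTrigPoly hS
      ((hgr τ).isConjSymm_coeffExt hS) (isConjSymm_laplacianCoeff ((hmem τ).1.isConjSymm_coeffExt hS)),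
      ← Finset.sum_coe_sort]
    exact Finset.sum_congr rfl fun k _ => by rw [coeffExt_coe]
  have hP_cont : ContinuousOn P (Icc 0 t) := by
    rw [funext hP_eq]
    refine continuousOn_finsetSum _ fun k _ => Complex.continuous_re.comp_continuousOn ?_
    refine ((continuous_apply k).comp_continuousOn hg_cont).inner ?_
    have hlap : (fun τ => -(((4 * Real.pi ^ 2 * freqNormSq (k : Fin 2 → ℤ) : ℝ) : ℂ) •
        coeffExt S (α τ) k)) =
        fun τ => (-(4 * Real.pi ^ 2 * freqNormSq (k : Fin 2 → ℤ)) : ℝ) • α τ k := by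
      funext τ; rw [neg_lapMul_smul_eq_real_smul, coeffExt_coe]
    rw [hlap]
    exact ((continuous_apply k).comp_continuousOn hα_cont).const_smul
      (-(4 * Real.pi ^ 2 * freqNormSq (k : Fin 2 → ℤ)) : ℝ)
  have hQ_cont : ContinuousOn Q (Icc 0 t) := by
    subst hQ; exact continuousOn_integral_norm_sq_galerkin hS hgr hg_cont
  have huIcc : uIcc 0 t = Icc 0 t := uIcc_of_le ht
  have hE₂_int : IntervalIntegrable E₂ volume 0 t := (hE₂_cont.mono huIcc.subset).intervalIntegrable
  have hP_int : IntervalIntegrable P volume 0 t := (hP_cont.mono huIcc.subset).intervalIntegrable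
  have hQ_int : IntervalIntegrable Q volume 0 t := (hQ_cont.mono huIcc.subset).intervalIntegrable
  have hD_int : IntervalIntegrable (fun τ => -2 * (ν * E₂ τ + P τ)) volume 0 t :=
    ((hE₂_int.const_mul ν).add hP_int).const_mul (-2)
  -- FTC on `[0, t]`
  have hFTC : ∫ τ in 0..t, -2 * (ν * E₂ τ + P τ) = E₁ t - E₁ 0 := by
    refine intervalIntegral.integral_eq_sub_of_hasDeriv_right_of_le ht ?_ ?_ hD_int
    · exact fun τ hτ => (hderiv t τ hτ).continuousWithinAt
    · intro τ hτ
      have h := hderiv t τ ⟨hτ.1.le, hτ.2.le⟩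
      exact (h.hasDerivAt (Icc_mem_nhds hτ.1 hτ.2)).hasDerivWithinAt
  -- the pointwise bound `-2 (ν E₂ + P) ≤ -ν E₂ + ν⁻¹ Q` (Young under the integral)
  have hpt : ∀ τ ∈ Icc 0 t, -2 * (ν * E₂ τ + P τ) ≤ -ν * E₂ τ + ν⁻¹ * Q τ := by
    intro τ _
    have hY : -(2 * P τ) ≤ ν * E₂ τ + ν⁻¹ * Q τ := by
      subst hP hE₂ hQ
      have hG : IsSmooth (realTrigPoly S (coeffExt S (g τ))) := isSmooth_realTrigPoly S _
      have hL : IsSmooth (laplacian (realTrigPoly S (coeffExt S (α τ)))) :=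
        (isSmooth_realTrigPoly S _).laplacian
      show -(2 * ∫ x, ⟪realTrigPoly S (coeffExt S (g τ)) x,
          laplacian (realTrigPoly S (coeffExt S (α τ))) x⟫_ℝ) ≤
        ν * (∫ x, ‖laplacian (realTrigPoly S (coeffExt S (α τ))) x‖ ^ 2) +
          ν⁻¹ * ∫ x, ‖realTrigPoly S (coeffExt S (g τ)) x‖ ^ 2
      rw [← integral_const_mul, ← integral_neg, ← integral_const_mul, ← integral_const_mul,
        ← integral_add ((hL.norm_sq.integrable).const_mul ν) ((hG.norm_sq.integrable).const_mul ν⁻¹)]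
      refine integral_mono ((hG.inner hL).integrable.const_mul 2).neg
        (((hL.norm_sq.integrable).const_mul ν).add ((hG.norm_sq.integrable).const_mul ν⁻¹))
        fun x => ?_
      exact neg_two_mul_inner_le hν _ _
    linarith
  have hmono : ∫ τ in 0..t, -2 * (ν * E₂ τ + P τ) ≤ ∫ τ in 0..t, (-ν * E₂ τ + ν⁻¹ * Q τ) :=
    intervalIntegral.integral_mono_on ht hD_int ((hE₂_int.const_mul (-ν)).add (hQ_int.const_mul ν⁻¹))
      hpt
  have hsplit : ∫ τ in 0..t, (-ν * E₂ τ + ν⁻¹ * Q τ) =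
      -ν * (∫ τ in 0..t, E₂ τ) + ν⁻¹ * ∫ τ in 0..t, Q τ := by
    rw [intervalIntegral.integral_add (hE₂_int.const_mul (-ν)) (hQ_int.const_mul ν⁻¹),
      intervalIntegral.integral_const_mul, intervalIntegral.integral_const_mul]
  have hE₂I : ∫ τ in 0..t, ∫ x, ‖laplacian (realTrigPoly S (coeffExt S (α τ))) x‖ ^ 2 =
      ∫ τ in 0..t, E₂ τ := by rw [hE₂]
  have hQI : ∫ τ in 0..t, ∫ x, ‖realTrigPoly S (coeffExt S (g τ)) x‖ ^ 2 = ∫ τ in 0..t, Q τ := by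
    rw [hQ]
  have hE₁t : (eGradNormSq (realTrigPoly S (coeffExt S (α t)))).toReal = E₁ t := by rw [hE₁]
  have hE₁0 : (eGradNormSq (realTrigPoly S (coeffExt S (α 0)))).toReal = E₁ 0 := by rw [hE₁]
  rw [hE₂I, hQI, hE₁t, hE₁0]
  rw [hsplit] at hmono
  linarith

/-- **The enstrophy inequality of 2-D Galerkin solutions, `ℝ≥0∞` form** (spectral norms and
lower Lebesgue integrals in time, as in `Torus.IsLerayHopfOn`): under the hypotheses of
`galerkin_enstrophy_inequality`, for `t ≥ 0`,
`eGradNormSq (u t) + ν ∫⁻_{(0,t)} eLaplacianNormSq (u τ) ≤ eGradNormSq (u 0) + ν⁻¹ ∫⁻_{(0,t)} ∫⁻ ‖G τ‖ₑ²`. [cite: FoiasManleyRosaTemam2001, Ch. II Thm. 7.4 and (A.65)–(A.67)] -/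
theorem galerkin_enstrophy_inequality_ennreal {ν : ℝ} (hν : 0 < ν) {S : Finset (Fin 2 → ℤ)}
    (hS : ∀ k ∈ S, -k ∈ S) {g : ℝ → ↥S → EuclideanSpace ℂ (Fin 2)} (hg : Continuous g)
    (hgr : ∀ t, IsRealCoeff (g t)) {α : ℝ → ↥S → EuclideanSpace ℂ (Fin 2)}
    (hmem : ∀ t, α t ∈ galerkinSubspace S)
    (hα : ∀ T, ∀ t ∈ Icc 0 T, HasDerivWithinAt α (galerkinRHS S ν (g t) (α t)) (Icc 0 T) t)
    {t : ℝ} (ht : 0 ≤ t) :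
    eGradNormSq (realTrigPoly S (coeffExt S (α t))) +
        ENNReal.ofReal ν * ∫⁻ τ in Ioo 0 t, eLaplacianNormSq (realTrigPoly S (coeffExt S (α τ))) ≤
      eGradNormSq (realTrigPoly S (coeffExt S (α 0))) +
        ENNReal.ofReal ν⁻¹ * ∫⁻ τ in Ioo 0 t, ∫⁻ x, ‖realTrigPoly S (coeffExt S (g τ)) x‖ₑ ^ 2 := by
  have hreal := galerkin_enstrophy_inequality hν hS hg hgr hmem hα ht
  have hα_cont : ContinuousOn α (Icc 0 t) := fun τ hτ => (hα t τ hτ).continuousWithinAt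
  -- the four conversions
  set E₂ : ℝ → ℝ := fun τ => ∫ x, ‖laplacian (realTrigPoly S (coeffExt S (α τ))) x‖ ^ 2 with hE₂
  set Q : ℝ → ℝ := fun τ => ∫ x, ‖realTrigPoly S (coeffExt S (g τ)) x‖ ^ 2 with hQ
  have hE₂nn : ∀ τ, 0 ≤ E₂ τ := fun τ => integral_nonneg fun x => sq_nonneg _
  have hQnn : ∀ τ, 0 ≤ Q τ := fun τ => integral_nonneg fun x => sq_nonneg _
  have hlap : ∀ τ, eLaplacianNormSq (realTrigPoly S (coeffExt S (α τ))) = ENNReal.ofReal (E₂ τ) := by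
    intro τ
    simp only [hE₂]
    rw [eLaplacianNormSq_realTrigPoly hS ((hmem τ).1.isConjSymm_coeffExt hS),
      integral_norm_sq_laplacian_realTrigPoly hS ((hmem τ).1.isConjSymm_coeffExt hS)]
  have hfor : ∀ τ, ∫⁻ x, ‖realTrigPoly S (coeffExt S (g τ)) x‖ₑ ^ 2 = ENNReal.ofReal (Q τ) :=
    fun τ => lintegral_enorm_sq_eq_ofReal (memLp_realTrigPoly S _ 2)
  have hgrad : ∀ τ, eGradNormSq (realTrigPoly S (coeffExt S (α τ))) =
      ENNReal.ofReal ((eGradNormSq (realTrigPoly S (coeffExt S (α τ)))).toReal) := fun τ => by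
    rw [eGradNormSq_coeffExt hS (hmem τ).1, ENNReal.toReal_ofReal (mul_nonneg (by positivity)
      (Finset.sum_nonneg fun k _ => mul_nonneg (freqNormSq_nonneg _) (sq_nonneg _)))]
  have hI₂ : ∫⁻ τ in Ioo 0 t, eLaplacianNormSq (realTrigPoly S (coeffExt S (α τ))) =
      ENNReal.ofReal (∫ τ in 0..t, E₂ τ) := by
    simp_rw [hlap]
    exact lintegral_Ioo_ofReal_eq_ofReal_intervalIntegral ht
      (continuousOn_integral_norm_sq_laplacian_galerkin hS hmem hα_cont) hE₂nn
  have hIQ : ∫⁻ τ in Ioo 0 t, ∫⁻ x, ‖realTrigPoly S (coeffExt S (g τ)) x‖ₑ ^ 2 =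
      ENNReal.ofReal (∫ τ in 0..t, Q τ) := by
    simp_rw [hfor]
    exact lintegral_Ioo_ofReal_eq_ofReal_intervalIntegral ht
      (continuousOn_integral_norm_sq_galerkin hS hgr hg.continuousOn) hQnn
  have hI₂nn : 0 ≤ ∫ τ in 0..t, E₂ τ := intervalIntegral.integral_nonneg ht fun τ _ => hE₂nn τ
  have hIQnn : 0 ≤ ∫ τ in 0..t, Q τ := intervalIntegral.integral_nonneg ht fun τ _ => hQnn τ
  rw [hI₂, hIQ, hgrad t, hgrad 0, ← ENNReal.ofReal_mul hν.le, ← ENNReal.ofReal_mul (inv_nonneg.2 hν.le),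
    ← ENNReal.ofReal_add ENNReal.toReal_nonneg (mul_nonneg hν.le hI₂nn),
    ← ENNReal.ofReal_add ENNReal.toReal_nonneg (mul_nonneg (inv_nonneg.2 hν.le) hIQnn)]
  exact ENNReal.ofReal_le_ofReal hreal

end ODE



/-! ### The Hopf–Galerkin scheme on `UnitAddTorus (Fin 2)` with the enstrophy inequality -/

section Scheme

open FunctionSpaces.Torus Torus

/-- **The Hopf–Galerkin scheme on `UnitAddTorus (Fin 2)` satisfies the enstrophy inequality** (Foias–Manley–Rosa–
Temam 2001, Ch. II Thm. 7.4, (A.65)–(A.67), at the Galerkin level; Kuksin–Shirikyan 2012, proof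
of Thm. 2.1.18; the scheme is that of Robinson–Rodrigo–Sadowski 2016, Thm. 4.4, Steps 1–2, as
constructed in `NS.exists_isHopfGalerkinScheme`). Let `ν > 0`, `u₀ ∈ L²(UnitAddTorus (Fin 2))` integrable and
weakly divergence free, and `f` space–time measurable with `∫₀ᵀ∫‖f‖² < ∞` for every `T > 0`.
Then the Hopf–Galerkin scheme `(N, F, U)` of `NS.exists_isHopfGalerkinScheme` (smoothed forces
`F n`, Galerkin solutions `U n` from the data `P_n u₀`) satisfies, for every `n` and `t ≥ 0`,
`‖∇U n(t)‖₂² + ν∫₀ᵗ‖ΔU n‖₂² ≤ ‖∇u₀‖₂² + ν⁻¹∫₀ᵗ‖F n‖₂²` (spectral norms, `ℝ≥0∞`; the right side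
may be infinite if `u₀ ∉ H¹`). [cite: FoiasManleyRosaTemam2001, Ch. II Thm. 7.4 and (A.65)–(A.67)] -/
theorem exists_isHopfGalerkinScheme_enstrophy (ν : ℝ) (hν : 0 < ν) (u₀ : UnitAddTorus (Fin 2) → EuclideanSpace ℝ (Fin 2))
    (hu₀ : MemLp u₀ 2 volume) (hdiv : FunctionSpaces.Torus.IsWeaklyDivFree u₀) (f : ℝ → UnitAddTorus (Fin 2) → EuclideanSpace ℝ (Fin 2))
    (hf : AEStronglyMeasurable (stLift f) (volume.restrict (Ioi 0 ×ˢ univ)))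
    (hf₂ : ∀ T, 0 < T → ∫⁻ t in Ioo 0 T, ∫⁻ x, ‖f t x‖ₑ ^ 2 < ⊤) :
    ∃ (N : ℕ → ℕ) (F U : ℕ → ℝ → UnitAddTorus (Fin 2) → EuclideanSpace ℝ (Fin 2)), IsHopfGalerkinScheme ν f u₀ N F U ∧
      ∀ n t, 0 ≤ t →
        eGradNormSq (U n t) + ENNReal.ofReal ν * ∫⁻ τ in Ioo 0 t, eLaplacianNormSq (U n τ) ≤
          eGradNormSq u₀ + ENNReal.ofReal ν⁻¹ * ∫⁻ τ in Ioo 0 t, ∫⁻ x, ‖F n τ x‖ₑ ^ 2 := by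
  -- the smoothed forces
  obtain ⟨g, hg_smooth, hg_real, hg_tend⟩ := exists_smooth_realTrigPoly_approx hf hf₂
  have hg_cont : ∀ n, Continuous (g n) := fun n => (hg_smooth n).continuous
  have hS : ∀ n : ℕ, ∀ k ∈ freqBall (d := Fin 2) n, -k ∈ freqBall n := fun n =>
    neg_mem_freqBall_of_mem
  -- the data of the Galerkin systems: `(û₀(k))_{|k| ≤ n}`
  set c₀ : (n : ℕ) → ↥(freqBall (d := Fin 2) n) → EuclideanSpace ℂ (Fin 2) :=
    fun n k => mFourierCoeff (FunctionSpaces.EuclideanSpace.complexify ∘ u₀) k with hc₀_def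
  have hc₀ : ∀ n, c₀ n ∈ galerkinSubspace (freqBall (d := Fin 2) n) := fun n =>
    ⟨isRealCoeff_mFourierCoeff (hu₀.integrable one_le_two),
      isSolenoidalCoeff_restrict (hdiv.isTransversal_mFourierCoeff hu₀ (freqBall n))⟩
  -- the global Galerkin solutions
  have hsol : ∀ n : ℕ, ∃ α : ℝ → ↥(freqBall (d := Fin 2) n) → EuclideanSpace ℂ (Fin 2),
      α 0 = c₀ n ∧ (∀ t, α t ∈ galerkinSubspace (freqBall n)) ∧ ContinuousOn α (Ici 0) ∧
      ∀ T, ∀ t ∈ Icc 0 T, HasDerivWithinAt α (galerkinRHS (freqBall n) ν (g n t) (α t))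
        (Icc 0 T) t := fun n =>
    exists_galerkin_solution ν hν.le (hS n) (hg_cont n) (hg_real n) (hc₀ n)
  choose α hα0 hαmem hαcont hαderiv using hsol
  -- the scheme
  refine ⟨id, fun n t => realTrigPoly (freqBall n) (coeffExt (freqBall n) (g n t)),
    fun n t => realTrigPoly (freqBall n) (coeffExt (freqBall n) (α n t)), ?_, ?_⟩
  · -- the datum is the Fourier truncation
    have hU0 : ∀ n, realTrigPoly (freqBall n) (coeffExt (freqBall n) (α n 0)) =
        fourierTruncate n u₀ := by
      intro n
      rw [hα0 n, fourierTruncate_eq]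
      exact realTrigPoly_coeffExt_restrict _
    -- band-limitation of Galerkin modes in `Finset` form
    have hband : ∀ {n : ℕ} {a : UnitAddTorus (Fin 2) → EuclideanSpace ℝ (Fin 2)}, IsGalerkinMode n a →
        ∀ k ∉ freqBall (d := Fin 2) n,
          mFourierCoeff (FunctionSpaces.EuclideanSpace.complexify ∘ a) k = 0 :=
      fun ha k hk => ha.mFourierCoeff_eq_zero (not_mem_freqBall.1 hk)
    exact
      { tendsto_order := tendsto_id
        smooth_force := fun n => contDiff_stLift_realTrigPoly (hg_smooth n)
        tendsto_force := hg_tend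
        continuousOn := fun n => continuousOn_stLift_realTrigPoly (hαcont n)
        isGalerkinMode := fun n t _ =>
          have h := galerkin_slice_props (hS n) (hαmem n t)
          ⟨h.1, h.2.1, fun k hk => h.2.2.2 k (not_mem_freqBall.2 hk)⟩
        isWeaklyDivFree := fun n t _ => (galerkin_slice_props (hS n) (hαmem n t)).2.2.1
        galerkin := fun n a ha s t hs hst =>
          galerkin_test_identity ν (hS n) (hg_cont n) (hg_real n) (hαmem n) (hαderiv n)
            ha.isSmooth ha.isDivFree (hband ha) hs hst
        energy_eq := fun n s t hs hst =>
          galerkin_energy_identity ν (hS n) (hg_cont n) (hg_real n) (hαmem n) (hαderiv n) hs hst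
        initial_inner := fun n a ha => by
          rw [hU0 n]
          exact integral_inner_fourierTruncate_eq hu₀ (ha.isSmooth.memLp 2) (hband ha)
        tendsto_initial := by
          have heq : (fun n => eLpNorm (realTrigPoly (freqBall n) (coeffExt (freqBall n) (α n 0)) -
              u₀) 2 volume) = fun n => eLpNorm (fourierTruncate n u₀ - u₀) 2 volume := by
            funext n; rw [hU0 n]
          rw [heq]
          exact tendsto_eLpNorm_fourierTruncate_sub hu₀ }
  · -- the enstrophy inequality, with `‖∇U n 0‖² = ‖∇P_n u₀‖² ≤ ‖∇u₀‖²`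
    intro n t ht
    have h := galerkin_enstrophy_inequality_ennreal hν (hS n) (hg_cont n) (hg_real n) (hαmem n)
      (hαderiv n) ht
    have h0 : eGradNormSq (realTrigPoly (freqBall n) (coeffExt (freqBall n) (α n 0))) ≤
        eGradNormSq u₀ := by
      have hU0 : realTrigPoly (freqBall n) (coeffExt (freqBall n) (α n 0)) = fourierTruncate n u₀ := by
        rw [hα0 n, fourierTruncate_eq]
        exact realTrigPoly_coeffExt_restrict _
      rw [hU0]
      exact eGradNormSq_fourierTruncate_le (hu₀.integrable one_le_two) n
    exact h.trans (add_le_add h0 le_rfl)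

end Scheme


/-! ### Passage to the limit: Fatou for the enstrophy, the force norms, `L²(0,T;H²)` -/

section Limit

open FunctionSpaces.Torus Torus

variable {d : Type*} [Fintype d] [DecidableEq d]

omit [DecidableEq d] in
/-- Measurability in time of the spectral `‖Δ·‖₂²` of a field whose Fourier coefficients are
a.e. strongly measurable in time (`eLaplacianNormSq = 16π⁴ ∑ₖ |k|⁴ ‖·̂(k)‖ₑ²`, a countable sum). [folklore] -/
theorem Torus.aemeasurable_eLaplacianNormSq_of_coeff {μ : Measure ℝ}
    {w : ℝ → UnitAddTorus d → EuclideanSpace ℝ d}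
    (hw : ∀ k, AEStronglyMeasurable
      (fun t => mFourierCoeff (FunctionSpaces.EuclideanSpace.complexify ∘ w t) k) μ) :
    AEMeasurable (fun t => eLaplacianNormSq (w t)) μ := by
  have h : (fun t => eLaplacianNormSq (w t)) = fun t => ENNReal.ofReal (16 * Real.pi ^ 4) *
      ∑' k : d → ℤ, (if k = 0 then 0 else ENNReal.ofReal (freqNormSq k)) ^ 2 *
        ‖mFourierCoeff (FunctionSpaces.EuclideanSpace.complexify ∘ w t) k‖ₑ ^ 2 := by
    funext t
    rw [eLaplacianNormSq, eHomSobolevSeminorm_two_sq_eq_tsum]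
  rw [h]
  exact (AEMeasurable.tsum fun k => ((hw k).enorm.pow_const 2).const_mul _).const_mul _

variable {ν : ℝ} {f : ℝ → UnitAddTorus d → EuclideanSpace ℝ d}
  {u₀ : UnitAddTorus d → EuclideanSpace ℝ d} {N : ℕ → ℕ}
  {F U : ℕ → ℝ → UnitAddTorus d → EuclideanSpace ℝ d}
  {u : ℝ → UnitAddTorus d → EuclideanSpace ℝ d}

/-- Measurability in time of `t ↦ ‖ΔU n(t)‖²` on `(0, T)` along a Hopf–Galerkin scheme. [folklore] -/
theorem IsHopfGalerkinScheme.aemeasurable_eLaplacianNormSq (hS : IsHopfGalerkinScheme ν f u₀ N F U)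
    (n : ℕ) (T : ℝ) :
    AEMeasurable (fun t => eLaplacianNormSq (U n t)) (volume.restrict (Ioo 0 T)) :=
  Torus.aemeasurable_eLaplacianNormSq_of_coeff fun k =>
    (hS.aestronglyMeasurable_mFourierCoeff n k).mono_measure
      (Measure.restrict_mono Ioo_subset_Ioi_self le_rfl)

omit [Fintype d] [DecidableEq d] in
/-- `‖a‖ₑ² ≤ (1 + δ)‖b‖ₑ² + (1 + δ⁻¹)‖a - b‖ₑ²` for `δ > 0` (`‖a‖ ≤ ‖a - b‖ + ‖b‖` and
`2xy ≤ δy² + δ⁻¹x²`). [folklore] -/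
theorem enorm_sq_le_add_mul_enorm_sub_sq {E : Type*} [NormedAddCommGroup E] (a b : E) {δ : ℝ}
    (hδ : 0 < δ) :
    ‖a‖ₑ ^ 2 ≤ ENNReal.ofReal (1 + δ) * ‖b‖ₑ ^ 2 + ENNReal.ofReal (1 + δ⁻¹) * ‖a - b‖ₑ ^ 2 := by
  have hr : ‖a‖ ^ 2 ≤ (1 + δ) * ‖b‖ ^ 2 + (1 + δ⁻¹) * ‖a - b‖ ^ 2 := by
    have h1 : ‖a‖ ≤ ‖a - b‖ + ‖b‖ := norm_le_norm_sub_add a b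
    have h2 : 2 * (‖a - b‖ * ‖b‖) ≤ δ * ‖b‖ ^ 2 + δ⁻¹ * ‖a - b‖ ^ 2 := by
      have key : δ * ‖b‖ ^ 2 + δ⁻¹ * ‖a - b‖ ^ 2 - 2 * (‖a - b‖ * ‖b‖) =
          δ⁻¹ * (‖a - b‖ - δ * ‖b‖) ^ 2 := by
        field_simp
        ring
      have : 0 ≤ δ⁻¹ * (‖a - b‖ - δ * ‖b‖) ^ 2 := by positivity
      linarith
    have h3 : ‖a‖ ^ 2 ≤ (‖a - b‖ + ‖b‖) ^ 2 := by
      exact pow_le_pow_left₀ (norm_nonneg _) h1 2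
    nlinarith
  have hl : ‖a‖ₑ ^ 2 = ENNReal.ofReal (‖a‖ ^ 2) := by
    rw [← ofReal_norm, ENNReal.ofReal_pow (norm_nonneg _)]
  have hr' : ENNReal.ofReal ((1 + δ) * ‖b‖ ^ 2 + (1 + δ⁻¹) * ‖a - b‖ ^ 2) =
      ENNReal.ofReal (1 + δ) * ‖b‖ₑ ^ 2 + ENNReal.ofReal (1 + δ⁻¹) * ‖a - b‖ₑ ^ 2 := by
    rw [ENNReal.ofReal_add (by positivity) (by positivity),
      ENNReal.ofReal_mul (by positivity : (0 : ℝ) ≤ 1 + δ),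
      ENNReal.ofReal_mul (by positivity : (0 : ℝ) ≤ 1 + δ⁻¹), ENNReal.ofReal_pow (norm_nonneg _),
      ENNReal.ofReal_pow (norm_nonneg _), ofReal_norm, ofReal_norm]
  rw [hl, ← hr']
  exact ENNReal.ofReal_le_ofReal hr

/-- **The smoothed forces do not carry more energy than the force, asymptotically**: since
`F n → f` in `L²((0,T) × T^d)`, for every `δ > 0` eventually
`∫₀ᵀ∫‖F n‖² ≤ (1 + δ) ∫₀ᵀ∫‖f‖² + δ` (the `δ`-splitting `enorm_sq_le_add_mul_enorm_sub_sq` under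
the double integral). [folklore] -/
theorem IsHopfGalerkinScheme.eventually_lintegral_force_le (hS : IsHopfGalerkinScheme ν f u₀ N F U)
    (hfm : AEStronglyMeasurable (stLift f) (volume.restrict (Ioi 0 ×ˢ univ))) {T : ℝ}
    (hT : 0 ≤ T) {δ : ℝ} (hδ : 0 < δ) :
    ∀ᶠ n in atTop, ∫⁻ t in Ioo 0 T, ∫⁻ x, ‖F n t x‖ₑ ^ 2 ≤
      ENNReal.ofReal (1 + δ) * (∫⁻ t in Ioo 0 T, ∫⁻ x, ‖f t x‖ₑ ^ 2) + ENNReal.ofReal δ := by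
  rcases hT.eq_or_lt with hT0 | hT0
  · refine Eventually.of_forall fun n => ?_
    rw [← hT0, Ioo_self, Measure.restrict_empty, lintegral_zero_measure]
    exact bot_le
  have hF := aestronglyMeasurable_uncurry_prod_of_stLift hfm T
  have hsplit : ∀ n, ∫⁻ t in Ioo 0 T, ∫⁻ x, ‖F n t x‖ₑ ^ 2 ≤
      ENNReal.ofReal (1 + δ) * (∫⁻ t in Ioo 0 T, ∫⁻ x, ‖f t x‖ₑ ^ 2) +
        ENNReal.ofReal (1 + δ⁻¹) * ∫⁻ t in Ioo 0 T, ∫⁻ x, ‖F n t x - f t x‖ₑ ^ 2 := by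
    intro n
    have hFn : AEStronglyMeasurable (Function.uncurry (F n)) ((volume.restrict (Ioo 0 T)).prod volume) :=
      (continuous_uncurry_of_continuous_stLift (hS.smooth_force n).continuous).aestronglyMeasurable
    have hdiff : AEStronglyMeasurable (fun p : ℝ × UnitAddTorus d => Function.uncurry (F n) p - Function.uncurry f p)
        ((volume.restrict (Ioo 0 T)).prod volume) := hFn.sub hF
    have hfslice : ∀ᵐ t ∂(volume.restrict (Ioo 0 T)),
        AEStronglyMeasurable (fun x => f t x) volume := hF.prodMk_left
    have hinner : ∀ᵐ t ∂(volume.restrict (Ioo 0 T)), ∫⁻ x, ‖F n t x‖ₑ ^ 2 ≤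
        ENNReal.ofReal (1 + δ) * (∫⁻ x, ‖f t x‖ₑ ^ 2) +
          ENNReal.ofReal (1 + δ⁻¹) * ∫⁻ x, ‖F n t x - f t x‖ₑ ^ 2 := by
      filter_upwards [hfslice] with t ht
      calc ∫⁻ x, ‖F n t x‖ₑ ^ 2 ≤ ∫⁻ x, (ENNReal.ofReal (1 + δ) * ‖f t x‖ₑ ^ 2 +
            ENNReal.ofReal (1 + δ⁻¹) * ‖F n t x - f t x‖ₑ ^ 2) :=
            lintegral_mono fun x => enorm_sq_le_add_mul_enorm_sub_sq _ _ hδ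
        _ = ENNReal.ofReal (1 + δ) * (∫⁻ x, ‖f t x‖ₑ ^ 2) +
            ENNReal.ofReal (1 + δ⁻¹) * ∫⁻ x, ‖F n t x - f t x‖ₑ ^ 2 := by
            rw [lintegral_add_left' ((ht.enorm.pow_const 2).const_mul _),
              lintegral_const_mul' _ _ ENNReal.ofReal_ne_top,
              lintegral_const_mul' _ _ ENNReal.ofReal_ne_top]
    have houter : AEMeasurable (fun t => ENNReal.ofReal (1 + δ) * ∫⁻ x, ‖f t x‖ₑ ^ 2)
        (volume.restrict (Ioo 0 T)) :=
      ((hF.aemeasurable.enorm.pow_const 2).lintegral_prod_right').const_mul _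
    calc ∫⁻ t in Ioo 0 T, ∫⁻ x, ‖F n t x‖ₑ ^ 2
        ≤ ∫⁻ t in Ioo 0 T, (ENNReal.ofReal (1 + δ) * (∫⁻ x, ‖f t x‖ₑ ^ 2) +
            ENNReal.ofReal (1 + δ⁻¹) * ∫⁻ x, ‖F n t x - f t x‖ₑ ^ 2) := lintegral_mono_ae hinner
      _ = ENNReal.ofReal (1 + δ) * (∫⁻ t in Ioo 0 T, ∫⁻ x, ‖f t x‖ₑ ^ 2) +
          ENNReal.ofReal (1 + δ⁻¹) * ∫⁻ t in Ioo 0 T, ∫⁻ x, ‖F n t x - f t x‖ₑ ^ 2 := by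
          rw [lintegral_add_left' houter, lintegral_const_mul' _ _ ENNReal.ofReal_ne_top,
            lintegral_const_mul' _ _ ENNReal.ofReal_ne_top]
  -- eventually the error term is at most `δ`
  have hsmall : ∀ᶠ n in atTop, ∫⁻ t in Ioo 0 T, ∫⁻ x, ‖F n t x - f t x‖ₑ ^ 2 ≤
      ENNReal.ofReal (δ / (1 + δ⁻¹)) :=
    (hS.tendsto_force T hT0).eventually (ge_mem_nhds (ENNReal.ofReal_pos.2 (by positivity)))
  filter_upwards [hsmall] with n hn
  refine (hsplit n).trans (add_le_add le_rfl ?_)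
  calc ENNReal.ofReal (1 + δ⁻¹) * ∫⁻ t in Ioo 0 T, ∫⁻ x, ‖F n t x - f t x‖ₑ ^ 2
      ≤ ENNReal.ofReal (1 + δ⁻¹) * ENNReal.ofReal (δ / (1 + δ⁻¹)) := mul_le_mul' le_rfl hn
    _ = ENNReal.ofReal δ := by
        rw [← ENNReal.ofReal_mul (by positivity)]
        congr 1
        field_simp

/-- **The enstrophy inequality passes to the limit** (Kuksin–Shirikyan 2012, end of the proofs
of Thm. 2.1.13 and Thm. 2.1.18: lower semicontinuity under the Galerkin limit; Foias–Manley–Rosa–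
Temam 2001, (A.65)–(A.67)). If the approximations of a Hopf–Galerkin scheme satisfy
`‖∇U n(t)‖² + ν∫₀ᵗ‖ΔU n‖² ≤ ‖∇u₀‖² + ν⁻¹∫₀ᵗ‖F n‖²` (`t ≥ 0`) and converge coefficientwise to `u`
at every `t ≥ 0`, then `‖∇u(t)‖² + ν∫₀ᵗ‖Δu‖² ≤ ‖∇u₀‖² + ν⁻¹∫₀ᵗ‖f‖²` for every `t ≥ 0`
(Fatou slicewise and in time; `∫₀ᵗ‖F n‖² → ∫₀ᵗ‖f‖²`). [cite: FoiasManleyRosaTemam2001, Ch. II Thm. 7.4 and (A.65)–(A.67)] -/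
theorem IsHopfGalerkinScheme.enstrophy_ineq_limit (hS : IsHopfGalerkinScheme ν f u₀ N F U)
    (hfm : AEStronglyMeasurable (stLift f) (volume.restrict (Ioi 0 ×ˢ univ)))
    (hEns : ∀ n t, 0 ≤ t →
      eGradNormSq (U n t) + ENNReal.ofReal ν * ∫⁻ τ in Ioo 0 t, eLaplacianNormSq (U n τ) ≤
        eGradNormSq u₀ + ENNReal.ofReal ν⁻¹ * ∫⁻ τ in Ioo 0 t, ∫⁻ x, ‖F n τ x‖ₑ ^ 2)
    (hc : ∀ t, 0 ≤ t → ∀ k, Tendsto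
      (fun n => mFourierCoeff (FunctionSpaces.EuclideanSpace.complexify ∘ U n t) k)
      atTop (𝓝 (mFourierCoeff (FunctionSpaces.EuclideanSpace.complexify ∘ u t) k)))
    {t : ℝ} (ht : 0 ≤ t) :
    eGradNormSq (u t) + ENNReal.ofReal ν * ∫⁻ τ in Ioo 0 t, eLaplacianNormSq (u τ) ≤
      eGradNormSq u₀ + ENNReal.ofReal ν⁻¹ * ∫⁻ τ in Ioo 0 t, ∫⁻ x, ‖f τ x‖ₑ ^ 2 := by
  set X : ℝ≥0∞ := ∫⁻ τ in Ioo 0 t, ∫⁻ x, ‖f τ x‖ₑ ^ 2 with hX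
  -- Fatou for the two terms of the left side
  have hG : eGradNormSq (u t) ≤ liminf (fun n => eGradNormSq (U n t)) atTop :=
    eGradNormSq_le_liminf_of_tendsto_mFourierCoeff hc ht
  have hL : ∫⁻ τ in Ioo 0 t, eLaplacianNormSq (u τ) ≤
      liminf (fun n => ∫⁻ τ in Ioo 0 t, eLaplacianNormSq (U n τ)) atTop :=
    calc ∫⁻ τ in Ioo 0 t, eLaplacianNormSq (u τ)
        ≤ ∫⁻ τ in Ioo 0 t, liminf (fun n => eLaplacianNormSq (U n τ)) atTop :=
          setLIntegral_mono' measurableSet_Ioo fun τ hτ =>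
            eLaplacianNormSq_le_liminf_of_tendsto_mFourierCoeff hc hτ.1.le
      _ ≤ liminf (fun n => ∫⁻ τ in Ioo 0 t, eLaplacianNormSq (U n τ)) atTop :=
          lintegral_liminf_le' fun n => hS.aemeasurable_eLaplacianNormSq n t
  have hνL : ENNReal.ofReal ν * ∫⁻ τ in Ioo 0 t, eLaplacianNormSq (u τ) ≤
      liminf (fun n => ENNReal.ofReal ν * ∫⁻ τ in Ioo 0 t, eLaplacianNormSq (U n τ)) atTop := by
    have hmono : Monotone fun x : ℝ≥0∞ => ENNReal.ofReal ν * x := fun a b h => mul_le_mul' le_rfl h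
    have hcont : Continuous fun x : ℝ≥0∞ => ENNReal.ofReal ν * x :=
      ENNReal.continuous_const_mul ENNReal.ofReal_ne_top
    have heq := hmono.map_liminf_of_continuousAt (F := atTop)
      (fun n => ∫⁻ τ in Ioo 0 t, eLaplacianNormSq (U n τ)) hcont.continuousAt
    refine (mul_le_mul' le_rfl hL).trans (le_of_eq ?_)
    rw [heq]
    rfl
  have hlhs : eGradNormSq (u t) + ENNReal.ofReal ν * ∫⁻ τ in Ioo 0 t, eLaplacianNormSq (u τ) ≤
      liminf (fun n => eGradNormSq (U n t) +
        ENNReal.ofReal ν * ∫⁻ τ in Ioo 0 t, eLaplacianNormSq (U n τ)) atTop :=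
    (add_le_add hG hνL).trans (liminf_add_liminf_le_liminf_add _ _)
  -- the right side, up to `δ`
  have hδ : ∀ δ : ℝ, 0 < δ → eGradNormSq (u t) + ENNReal.ofReal ν * ∫⁻ τ in Ioo 0 t, eLaplacianNormSq (u τ) ≤
      eGradNormSq u₀ + ENNReal.ofReal ν⁻¹ * (ENNReal.ofReal (1 + δ) * X + ENNReal.ofReal δ) := by
    intro δ hδ
    refine hlhs.trans (liminf_le_of_frequently_le' (Eventually.frequently ?_))
    filter_upwards [hS.eventually_lintegral_force_le hfm ht hδ] with n hn
    exact (hEns n t ht).trans (add_le_add le_rfl (mul_le_mul' le_rfl hn))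
  -- let `δ → 0⁺`
  have hlim : Tendsto (fun δ : ℝ => eGradNormSq u₀ +
      ENNReal.ofReal ν⁻¹ * (ENNReal.ofReal (1 + δ) * X + ENNReal.ofReal δ)) (𝓝[>] 0)
      (𝓝 (eGradNormSq u₀ + ENNReal.ofReal ν⁻¹ * (ENNReal.ofReal (1 + 0) * X + ENNReal.ofReal 0))) := by
    refine tendsto_const_nhds.add (ENNReal.Tendsto.const_mul ?_ (Or.inr ENNReal.ofReal_ne_top))
    refine Tendsto.add (ENNReal.Tendsto.mul_const ?_ (Or.inl ?_)) ?_
    · exact (ENNReal.continuous_ofReal.tendsto _).comp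
        ((tendsto_const_nhds.add tendsto_id).mono_left nhdsWithin_le_nhds)
    · simp
    · exact (ENNReal.continuous_ofReal.tendsto _).comp (tendsto_id.mono_left nhdsWithin_le_nhds)
  simp only [add_zero, ENNReal.ofReal_one, one_mul, ENNReal.ofReal_zero] at hlim
  exact ge_of_tendsto hlim (eventually_nhdsWithin_of_forall fun δ hδ' => hδ δ hδ')

/-- **The limit lies in `L²(0,T;H²)`** when its enstrophy dissipation integral is finite
(Kuksin–Shirikyan 2012, Thm. 2.1.18: `u ∈ L²(t₀,T;H²)`; here from `0` for `H¹` data): a.e.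
slice is in `H²` and `∫₀ᵀ‖u‖²_{H²} < ∞`, from the uniform `L²` bound of the limit
(`energy_bound_limit`) and `∫₀ᵀ ‖Δu‖² < ∞`. [cite: KuksinShirikyan2012, Thm. 2.1.18] -/
theorem IsHopfGalerkinScheme.memL2Sobolev_two_limit (hS : IsHopfGalerkinScheme ν f u₀ N F U)
    (hν : 0 < ν) (hu₀ : MemLp u₀ 2 volume)
    (hfm : AEStronglyMeasurable (stLift f) (volume.restrict (Ioi 0 ×ˢ univ)))
    (hf₂ : ∀ T, 0 < T → ∫⁻ t in Ioo 0 T, ∫⁻ x, ‖f t x‖ₑ ^ 2 < ⊤)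
    (hu : ∀ t, 0 ≤ t → MemLp (u t) 2 volume)
    (hc : ∀ t, 0 ≤ t → ∀ k, Tendsto
      (fun n => mFourierCoeff (FunctionSpaces.EuclideanSpace.complexify ∘ U n t) k)
      atTop (𝓝 (mFourierCoeff (FunctionSpaces.EuclideanSpace.complexify ∘ u t) k))) {T : ℝ} (hT : 0 < T)
    (hLap : ∫⁻ t in Ioo 0 T, eLaplacianNormSq (u t) < ⊤) :
    MemL2Sobolev 0 T 2 (fun t => FunctionSpaces.EuclideanSpace.complexify ∘ u t) := by
  obtain ⟨C, hC⟩ := hS.energy_bound_limit hν.le hu₀ hfm hf₂ hu hc hT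
  -- measurability of the limit coefficients on `(0, T)` (limits of measurable functions)
  have hcm : ∀ k, AEStronglyMeasurable
      (fun t => mFourierCoeff (FunctionSpaces.EuclideanSpace.complexify ∘ u t) k)
      (volume.restrict (Ioo 0 T)) := by
    intro k
    refine aestronglyMeasurable_of_tendsto_ae atTop
      (fun n => (hS.aestronglyMeasurable_mFourierCoeff n k).mono_measure
        (Measure.restrict_mono Ioo_subset_Ioi_self le_rfl)) ?_
    filter_upwards [ae_restrict_mem measurableSet_Ioo] with t ht
    exact hc t ht.1.le k
  have hLm : AEMeasurable (fun t => eLaplacianNormSq (u t)) (volume.restrict (Ioo 0 T)) :=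
    Torus.aemeasurable_eLaplacianNormSq_of_coeff hcm
  refine ⟨?_, ?_⟩
  · filter_upwards [ae_lt_top' hLm hLap.ne, hC, ae_restrict_mem measurableSet_Ioo] with t hLt hCt ht
    refine ⟨integrable_complexify_comp ((hu t ht.1.le).integrable one_le_two), ?_⟩
    have h := eSobolevNorm_two_complexify_sq_le (hu t ht.1.le)
    have hfin : 2 * (∫⁻ x, ‖u t x‖ₑ ^ 2) + 2 * eLaplacianNormSq (u t) < ⊤ :=
      ENNReal.add_lt_top.2 ⟨ENNReal.mul_lt_top (by norm_num) (lt_of_le_of_lt hCt ENNReal.coe_lt_top),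
        ENNReal.mul_lt_top (by norm_num) hLt⟩
    have h2 : eSobolevNorm 2 (FunctionSpaces.EuclideanSpace.complexify ∘ u t) ^ 2 < ⊤ := lt_of_le_of_lt h hfin
    by_contra htop
    rw [not_lt, top_le_iff] at htop
    rw [htop, ENNReal.top_pow two_ne_zero] at h2
    exact lt_irrefl _ h2
  · rw [eL2SobolevNorm]
    refine ENNReal.rpow_lt_top_of_nonneg (by norm_num) (lt_top_iff_ne_top.1 ?_)
    calc ∫⁻ t in Ioo 0 T, eSobolevNorm 2 (FunctionSpaces.EuclideanSpace.complexify ∘ u t) ^ 2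
        ≤ ∫⁻ t in Ioo 0 T, (2 * (∫⁻ x, ‖u t x‖ₑ ^ 2) + 2 * eLaplacianNormSq (u t)) :=
          setLIntegral_mono' measurableSet_Ioo fun t ht =>
            eSobolevNorm_two_complexify_sq_le (hu t ht.1.le)
      _ ≤ ∫⁻ t in Ioo 0 T, (2 * (C : ℝ≥0∞) + 2 * eLaplacianNormSq (u t)) := by
          refine lintegral_mono_ae ?_
          filter_upwards [hC] with t hCt
          exact add_le_add (mul_le_mul' le_rfl hCt) le_rfl
      _ = (∫⁻ _ in Ioo 0 T, 2 * (C : ℝ≥0∞)) + 2 * ∫⁻ t in Ioo 0 T, eLaplacianNormSq (u t) := by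
          rw [lintegral_add_left' aemeasurable_const, lintegral_const_mul'' _ hLm]
      _ < ⊤ := by
          rw [setLIntegral_const]
          exact ENNReal.add_lt_top.2 ⟨ENNReal.mul_lt_top (ENNReal.mul_lt_top (by norm_num)
            ENNReal.coe_lt_top) measure_Ioo_lt_top, ENNReal.mul_lt_top (by norm_num) hLap⟩

end Limit


/-! ### Assembly on `UnitAddTorus (Fin 2)`: discharge of `fmrt_strong_existence_torus2` -/

section Assembly

open FunctionSpaces.Torus Torus

/-- `u₀ ∈ H¹` (spectrally) has finite spectral gradient norm: `eGradNormSq u₀ < ∞`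
(`|·|_{Ḣ¹} ≤ ‖·‖_{H¹}`). [folklore] -/
theorem eGradNormSq_lt_top_of_memSobolev_one {d : Type*} [Fintype d]
    {v : UnitAddTorus d → EuclideanSpace ℝ d}
    (hv : MemSobolev 1 (FunctionSpaces.EuclideanSpace.complexify ∘ v)) : eGradNormSq v < ⊤ := by
  unfold eGradNormSq
  refine ENNReal.mul_lt_top ENNReal.ofReal_lt_top ?_
  have h := Torus.eHomSobolevSeminorm_le_eSobolevNorm zero_le_one
    (FunctionSpaces.EuclideanSpace.complexify ∘ v)
  exact lt_of_le_of_lt (pow_le_pow_left' h 2) (ENNReal.pow_lt_top hv.2)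

/-- **Global strong solutions on `UnitAddTorus (Fin 2)` with the enstrophy inequality, constructed** (Foias–
Manley–Rosa–Temam 2001, Ch. II Thm. 7.4 — existence half — with (7.17) and (A.65)–(A.67);
Kuksin–Shirikyan 2012, Thm. 2.1.13, Lemma 2.1.16, Thm. 2.1.18): for `ν > 0`, `u₀ ∈ V` (`H¹`
spectrally, weakly divergence free) and a space–time measurable force square integrable on every
`(0,T) × UnitAddTorus (Fin 2)`, the Leray–Hopf limit of the Hopf–Galerkin scheme
(`exists_isHopfGalerkinScheme_enstrophy`, `exists_limitField`, `isLerayHopfOn_limit`) lies in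
`L²(0,T;H²)` for every `T > 0` and satisfies
`‖∇u(t)‖₂² + ν∫₀ᵗ‖Δu‖₂² ≤ ‖∇u₀‖₂² + ν⁻¹∫₀ᵗ‖f‖₂²` for every `t ≥ 0` (the statement of the named
fact `fmrt_strong_existence_torus2` of `NSStrongSolutions2D`). [cite: FoiasManleyRosaTemam2001, Ch. II Thm. 7.4 and (A.65)–(A.67)] -/
theorem strong_existence_enstrophy_torus2 (ν : ℝ) (hν : 0 < ν) (u₀ : UnitAddTorus (Fin 2) → EuclideanSpace ℝ (Fin 2))
    (hu₀ : MemSobolev 1 (FunctionSpaces.EuclideanSpace.complexify ∘ u₀))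
    (hdiv : FunctionSpaces.Torus.IsWeaklyDivFree u₀) (f : ℝ → UnitAddTorus (Fin 2) → EuclideanSpace ℝ (Fin 2))
    (hf : AEStronglyMeasurable (stLift f) (volume.restrict (Ioi 0 ×ˢ univ)))
    (hf₂ : ∀ T, 0 < T → ∫⁻ t in Ioo 0 T, ∫⁻ x, ‖f t x‖ₑ ^ 2 < ⊤) :
    ∃ u : ℝ → UnitAddTorus (Fin 2) → EuclideanSpace ℝ (Fin 2), Torus.IsGlobalLerayHopf ν f u₀ u ∧
      (∀ T, 0 < T → MemL2Sobolev 0 T 2 (fun t => FunctionSpaces.EuclideanSpace.complexify ∘ u t)) ∧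
      ∀ t, 0 ≤ t →
        eGradNormSq (u t) + ENNReal.ofReal ν * ∫⁻ s in Ioo 0 t, eLaplacianNormSq (u s) ≤
          eGradNormSq u₀ + ENNReal.ofReal ν⁻¹ * ∫⁻ s in Ioo 0 t, ∫⁻ x, ‖f s x‖ₑ ^ 2 := by
  have hu₀L2 : MemLp u₀ 2 volume := memLp_of_memSobolev_complexify zero_le_one hu₀
  obtain ⟨N, F, U, hS, hEns⟩ := exists_isHopfGalerkinScheme_enstrophy ν hν u₀ hu₀L2 hdiv f hf hf₂
  obtain ⟨φ, hφ, u, hum, hu, hc⟩ := hS.exists_limitField hν.le hu₀L2 hf hf₂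
  have hS' := hS.comp_strictMono hφ
  have hEns' : ∀ n t, 0 ≤ t →
      eGradNormSq ((U ∘ φ) n t) + ENNReal.ofReal ν * ∫⁻ τ in Ioo 0 t, eLaplacianNormSq ((U ∘ φ) n τ) ≤
        eGradNormSq u₀ + ENNReal.ofReal ν⁻¹ * ∫⁻ τ in Ioo 0 t, ∫⁻ x, ‖(F ∘ φ) n τ x‖ₑ ^ 2 :=
    fun n t ht => hEns (φ n) t ht
  have hineq : ∀ t, 0 ≤ t →
      eGradNormSq (u t) + ENNReal.ofReal ν * ∫⁻ τ in Ioo 0 t, eLaplacianNormSq (u τ) ≤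
        eGradNormSq u₀ + ENNReal.ofReal ν⁻¹ * ∫⁻ τ in Ioo 0 t, ∫⁻ x, ‖f τ x‖ₑ ^ 2 :=
    fun t ht => hS'.enstrophy_ineq_limit hf hEns' hc ht
  refine ⟨u, fun T hT => hS'.isLerayHopfOn_limit hν hu₀L2 hdiv hf hf₂ hum hu hc hT,
    fun T hT => ?_, hineq⟩
  -- `∫₀ᵀ ‖Δu‖² < ∞` from the enstrophy inequality (`u₀ ∈ H¹`, `f ∈ L²`, `ν > 0`)
  have hrhs : eGradNormSq u₀ + ENNReal.ofReal ν⁻¹ * ∫⁻ τ in Ioo 0 T, ∫⁻ x, ‖f τ x‖ₑ ^ 2 < ⊤ :=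
    ENNReal.add_lt_top.2 ⟨eGradNormSq_lt_top_of_memSobolev_one hu₀,
      ENNReal.mul_lt_top ENNReal.ofReal_lt_top (hf₂ T hT)⟩
  have hmul : ENNReal.ofReal ν * ∫⁻ τ in Ioo 0 T, eLaplacianNormSq (u τ) < ⊤ :=
    lt_of_le_of_lt (le_add_self.trans (hineq T hT.le)) hrhs
  have hLap : ∫⁻ τ in Ioo 0 T, eLaplacianNormSq (u τ) < ⊤ :=
    ENNReal.lt_top_of_mul_ne_top_right hmul.ne ((ENNReal.ofReal_pos.2 hν).ne')
  exact hS'.memL2Sobolev_two_limit hν hu₀L2 hf hf₂ hu hc hT hLap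

/-- **Discharge of the named fact `fmrt_strong_existence_torus2`** (`NSStrongSolutions2D`;
Foias–Manley–Rosa–Temam 2001, Ch. II Thm. 7.4, existence half, with (7.17) and (A.65)–(A.67);
Kuksin–Shirikyan 2012, Thm. 2.1.13, Lemma 2.1.16, Thm. 2.1.18, (2.43)): by
`strong_existence_enstrophy_torus2`. [cite: FoiasManleyRosaTemam2001, Ch. II Thm. 7.4 and (A.65)–(A.67)] -/
theorem fmrt_strong_existence_torus2_holds : fmrt_strong_existence_torus2 :=
  fun ν hν u₀ hu₀ hdiv f hf hf₂ => strong_existence_enstrophy_torus2 ν hν u₀ hu₀ hdiv f hf hf₂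

end Assembly

end Literature.Analysis.FluidPDE

end
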